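import Mathlib
import Summits.Ventures.HodgeRepro.Tier4.Common.AdelicDefs
import Summits.Ventures.HodgeRepro.Tier4.Common.CompactOpenLevel
import Summits.Ventures.HodgeRepro.Tier4.Common.LevelBasis
import Summits.Ventures.HodgeRepro.Tier4.Line1.RTFSetting
import Summits.Ventures.HodgeRepro.Tier4.Line1.OrbitalTools
import Summits.Ventures.HodgeRepro.Tier4.Line1.RationalPoints
import Summits.Ventures.HodgeRepro.Tier4.Line1.RealisedSetting
import Summits.Ventures.HodgeRepro.Tier4.Line1.AdelicParts
import Summits.Ventures.HodgeRepro.Tier4.Line1.RationalConjFinite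
import Summits.Ventures.HodgeRepro.Tier4.Line1.FiniteLevelIsolation

/-!
# Tier4/Line4/IsolationArchCompact — C-L4-ISOLPROJ: finite-level isolation with a COMPACT ARCHIMEDEAN SUPPORT

Blind re-derivation cell `pub-hodge-repro`, Tier 4 «PROVE THE STEP» (README §9–§10), LINE L4 (the seesaw / mixed plane),
seat t4-L2-p1 g2 re-pointed by the lead (S14100 / S14126) onto t4-plan-4 g2's cut C-L4-ISOLPROJ (S14129, census §11).

t4-L1-p4's `exists_level_isolating_of_compact` (Tier4/Line1/FiniteLevelIsolation p688048) isolates the rational double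
coset of a linearly regular `γ₀` at a deep congruence level with NO archimedean condition — PROVIDED the archimedean
group `G_∞ = infinitePart W` is compact (true on totally definite planes, false on the MIXED seesaw plane, where
`U(1,1)` sits at the distinguished real place).  The weak W5 on the projector class (census §11 / L4-MATH.md §14′) does not
need the whole archimedean fibre: the test functions of the class have COMPACT archimedean support.  This module is the
twin statement with a compact subset `Ω ⊆ infinitePart W` in place of the group: the proof is t4-L1-p4's with ONE
substitution — the compact set at level `1` is `γ₀ • (Ω * K(1))`, the separation `compact_open_separated_mul_right` is
applied to `Ω` (compact by hypothesis), and `Ω ⊆ G_∞` is what makes the finite part of an element of `γ₀ • (Ω * K(N))`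
lie in `γ₀,f · K(N)`, so that finite-adelic J2.b (`orbitOf_eq_of_finPart_conj`, contrapositive) still excludes every
rational point outside the double coset of `γ₀` (crit-2 Entry 99 §2 read it this way, S14038).

CONSUMER: `Jc (e ⋆ h ⋆ e) = O_{γ₀}(e ⋆ h ⋆ e)` for `h` supported in `γ₀ • (Ω × K(N))` (`Jc_eq_orbital_of_isolated`,
DistributionNonzeroPair) — the weak W5 in the projector class.  No printed input.  Nothing here says anything about the
status of the Hodge conjecture for CM abelian varieties, which is NOT proved (HC_CM is NOT proved by anyone in this
repository).  The declarations live in the `Line1` namespace beside their twin (same name resolution); the file sits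
under `Line4/` as the consumer's line (t4-plan-4 g2 S14129).
-/

set_option autoImplicit false

noncomputable section

namespace Summit.Ventures.HodgeRepro.Tier4.Line1

open Matrix NumberField IsDedekindDomain Topology Summit.Ventures.HodgeRepro.Tier4.Common
open scoped NumberField Pointwise

section Isolation

open MeasureTheory

variable {k : Type} [Field k] [NumberField k] (W : PlaneData k) [MeasurableSpace (GA W)] [BorelSpace (GA W)]
  (hW : IsDefinite W) (hg : IsGenuineRow W) (R : RTFData W) (μ : Measure (GA W)) [μ.IsHaarMeasure]
  [R.μT.IsHaarMeasure] [R.μT'.IsHaarMeasure] (hT : IsCompact (closure R.DT)) (hT' : IsCompact (closure R.DT'))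

/-- **C-L4-ISOLPROJ — finite-level isolation with a compact archimedean support**: for a compact `Ω ⊆ G_∞` there is a
level `N ≠ 0` such that every rational `γ` with `t⁻¹ γ t′ ∈ γ₀ • (Ω · K(N))` for some `t ∈ closure DT`, `t′ ∈ closure DT′`
lies in the rational double coset of `γ₀` — `exists_level_isolating_of_compact` with `hcomp : IsCompact G_∞` replaced by
`(Ω, hΩ : Ω ⊆ G_∞, hΩc : IsCompact Ω)`; the same proof. -/
theorem exists_level_isolating_of_archCompact (Ω : Set (GA W)) (hΩ : Ω ⊆ (infinitePart W : Set (GA W)))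
    (hΩc : IsCompact Ω) (γ₀ : rationalPoints W) (hreg : IsLinRegular W γ₀) :
    ∃ N : ℕ, N ≠ 0 ∧ ∀ t ∈ closure (Setting.ofAdelic W hW hg R μ hT hT').DT,
      ∀ t' ∈ closure (Setting.ofAdelic W hW hg R μ hT hT').DT', ∀ γ : (Setting.ofAdelic W hW hg R μ hT hT').Gk,
        (t : GA W)⁻¹ * γ * t' ∈ (γ₀ : GA W) • (Ω * (levelK W N : Set (GA W))) →
        (Setting.ofAdelic W hW hg R μ hT hT').orbitOf γ = (Setting.ofAdelic W hW hg R μ hT hT').orbitOf γ₀ := by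
  classical
  haveI : T2Space (GA W) := t2Space_GA W
  -- the compact set at level `1` and the finite set of rational points it hits
  have hK1 : IsCompact (levelK W 1 : Set (GA W)) := isCompact_levelK W one_ne_zero
  have hM : IsCompact ((γ₀ : GA W) • (Ω * (levelK W 1 : Set (GA W)))) := (hΩc.mul hK1).smul _
  -- for every rational point outside the double coset of `γ₀`, a level that separates it
  have hbad : ∀ γ : (Setting.ofAdelic W hW hg R μ hT hT').Gk,
      (Setting.ofAdelic W hW hg R μ hT hT').orbitOf γ ≠ (Setting.ofAdelic W hW hg R μ hT hT').orbitOf γ₀ →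
      ∃ Nγ : ℕ, Nγ ≠ 0 ∧ ∀ t ∈ closure (Setting.ofAdelic W hW hg R μ hT hT').DT,
        ∀ t' ∈ closure (Setting.ofAdelic W hW hg R μ hT hT').DT',
        (t : GA W)⁻¹ * γ * t' ∉ (γ₀ : GA W) • (Ω * (levelK W Nγ : Set (GA W))) := by
    intro γ hne
    have hA : IsCompact ((fun t : (Setting.ofAdelic W hW hg R μ hT hT').T => (t : GA W)) ''
        closure (Setting.ofAdelic W hW hg R μ hT hT').DT) :=
      (Setting.ofAdelic W hW hg R μ hT hT').compT.image continuous_subtype_val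
    have hB : IsCompact ((fun t : (Setting.ofAdelic W hW hg R μ hT hT').T' => (t : GA W)) ''
        closure (Setting.ofAdelic W hW hg R μ hT hT').DT') :=
      (Setting.ofAdelic W hW hg R μ hT hT').compT'.image continuous_subtype_val
    -- the compact set `C = γ₀⁻¹ · {t⁻¹ γ t′}`
    set C : Set (GA W) := (fun p : GA W × GA W => (γ₀ : GA W)⁻¹ * (p.1⁻¹ * γ * p.2)) ''
      (((fun t : (Setting.ofAdelic W hW hg R μ hT hT').T => (t : GA W)) ''
          closure (Setting.ofAdelic W hW hg R μ hT hT').DT) ×ˢ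
        ((fun t : (Setting.ofAdelic W hW hg R μ hT hT').T' => (t : GA W)) ''
          closure (Setting.ofAdelic W hW hg R μ hT hT').DT')) with hCdef
    have hC : IsCompact C :=
      (hA.prod hB).image (continuous_const.mul ((continuous_fst.inv.mul continuous_const).mul continuous_snd))
    -- `C` misses `G_∞`: finite-adelic J2.b
    have hdisj : ∀ t ∈ closure (Setting.ofAdelic W hW hg R μ hT hT').DT,
        ∀ t' ∈ closure (Setting.ofAdelic W hW hg R μ hT hT').DT',
        (γ₀ : GA W)⁻¹ * ((t : GA W)⁻¹ * γ * t') ∉ infinitePart W := by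
      intro t _ t' _ hmem
      apply hne
      have h1 : finM k (GA.mat W ((t : GA W)⁻¹ * γ * t')) = finM k (GA.mat W (γ₀ : GA W)) := by
        have hm := (mem_infinitePart W _).1 hmem
        rw [GA.mat_mul, finM_mul] at hm
        calc finM k (GA.mat W ((t : GA W)⁻¹ * γ * t'))
            = (finM k (GA.mat W (γ₀ : GA W)) * finM k (GA.mat W (γ₀ : GA W)⁻¹)) *
                finM k (GA.mat W ((t : GA W)⁻¹ * γ * t')) := by
              rw [← finM_mul, GA.mat_mul_inv, finM_one, Matrix.one_mul]
          _ = finM k (GA.mat W (γ₀ : GA W)) *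
                (finM k (GA.mat W (γ₀ : GA W)⁻¹) * finM k (GA.mat W ((t : GA W)⁻¹ * γ * t'))) :=
              Matrix.mul_assoc _ _ _
          _ = finM k (GA.mat W (γ₀ : GA W)) := by rw [hm, Matrix.mul_one]
      exact orbitOf_eq_of_finPart_conj W hW hg R μ hT hT' γ γ₀ hreg t.2 t'.2
        (fun i j => congrFun (congrFun h1 i) j)
    have hU : IsOpen Cᶜ := hC.isClosed.isOpen_compl
    -- `Ω ⊆ G_∞` misses `C` as well
    have hsub : Ω ⊆ Cᶜ := by
      rintro a ha ⟨⟨_, _⟩, ⟨⟨τ, hτ, rfl⟩, ⟨τ', hτ', rfl⟩⟩, hfa⟩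
      have ha' : a ∈ infinitePart W := hΩ ha
      rw [← hfa] at ha'
      exact hdisj τ hτ τ' hτ' ha'
    obtain ⟨V, hV, hVsub⟩ := compact_open_separated_mul_right hΩc hU hsub
    obtain ⟨Nγ, hNγ, hKV⟩ := exists_levelK_subset_nhds_one W hV
    refine ⟨Nγ, hNγ, fun t ht t' ht' hmem => ?_⟩
    rw [Set.mem_smul_set_iff_inv_smul_mem, smul_eq_mul] at hmem
    have hin : (γ₀ : GA W)⁻¹ * ((t : GA W)⁻¹ * γ * t') ∈ C :=
      ⟨((t : GA W), (t' : GA W)), ⟨⟨t, ht, rfl⟩, ⟨t', ht', rfl⟩⟩, rfl⟩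
    exact hVsub (Set.mul_subset_mul_left hKV hmem) hin
  choose! Nf hNf using hbad
  -- the finite set of rational points hit at level `1`, and the product level over its bad members
  set Γ : Finset (Setting.ofAdelic W hW hg R μ hT hT').Gk :=
    ((Setting.ofAdelic W hW hg R μ hT hT').finite_hit_closure hM).toFinset with hΓ
  set N : ℕ := ∏ γ ∈ Γ.filter (fun γ =>
    (Setting.ofAdelic W hW hg R μ hT hT').orbitOf γ ≠ (Setting.ofAdelic W hW hg R μ hT hT').orbitOf γ₀), Nf γ
    with hN
  refine ⟨N, ?_, ?_⟩
  · rw [hN, Finset.prod_ne_zero_iff]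
    intro γ hγ
    exact (hNf γ (Finset.mem_filter.1 hγ).2).1
  · intro t ht t' ht' γ hmem
    by_contra hne
    have hγΓ : γ ∈ Γ := by
      rw [hΓ, Set.Finite.mem_toFinset]
      refine ⟨t, ht, t', ht', ?_⟩
      exact Set.smul_set_mono
        (Set.mul_subset_mul_left (SetLike.coe_subset_coe.2 (levelK_antitone W (one_dvd N)))) hmem
    have hdvd : Nf γ ∣ N := Finset.dvd_prod_of_mem _ (Finset.mem_filter.2 ⟨hγΓ, hne⟩)
    exact (hNf γ hne).2 t ht t' ht'
      (Set.smul_set_mono (Set.mul_subset_mul_left (SetLike.coe_subset_coe.2 (levelK_antitone W hdvd))) hmem)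

/-- The group form is the special case `Ω = G_∞` (consistency with `exists_level_isolating_of_compact`). -/
theorem exists_level_isolating_of_compact' (hcomp : IsCompact (infinitePart W : Set (GA W)))
    (γ₀ : rationalPoints W) (hreg : IsLinRegular W γ₀) :
    ∃ N : ℕ, N ≠ 0 ∧ ∀ t ∈ closure (Setting.ofAdelic W hW hg R μ hT hT').DT,
      ∀ t' ∈ closure (Setting.ofAdelic W hW hg R μ hT hT').DT', ∀ γ : (Setting.ofAdelic W hW hg R μ hT hT').Gk,
        (t : GA W)⁻¹ * γ * t' ∈ (γ₀ : GA W) • ((infinitePart W : Set (GA W)) * (levelK W N : Set (GA W))) →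
        (Setting.ofAdelic W hW hg R μ hT hT').orbitOf γ = (Setting.ofAdelic W hW hg R μ hT hT').orbitOf γ₀ :=
  exists_level_isolating_of_archCompact W hW hg R μ hT hT' (infinitePart W : Set (GA W)) le_rfl hcomp γ₀ hreg

end Isolation

end Summit.Ventures.HodgeRepro.Tier4.Line1

end
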